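import Summits.Ventures.QEC.Theorems.BB72DistanceCertificateTarget
import Summits.Ventures.QEC.Decoders.BB72SyndromeTable
import Summits.Ventures.QEC.Decoders.BBOptimalRadius
import HarnessLib

/-!
# `[[72,12,6]]`: correction radius `2` is OPTIMAL among all decoders, and attained (KERNEL) — the Q4 «theorem column»
# of the benchmark code, read off the certified distance (route BB72DistanceCertificate, item Target, CLOSED)

HONEST FRAMING: CERTIFIED column, tier KERNEL (no new `decide`; axioms ⊆ {propext, Classical.choice, Quot.sound}).
Everything here is a COROLLARY of two accepted kernel facts: the certified distances `d_X = d_Z = 6` of the certificate's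
code (`BB72.dX_cert` / `BB72.dZ_cert`, `Theorems/BB72DistanceCertificateTarget.lean`, from the meet-in-the-middle replays)
and the attained radius `2` of the syndrome-table decoder (`Decoders/BB72SyndromeTable.lean`). This is a LEAF file
(consequences of the closed route for decoding); it imports the route's closer, nothing imports it (build rule
2026-08-26T18:52:29Z: only closer/leaf files sit above a Theses module).

Statements (all PROVED), for `code = BB72.cert.code _` (qubits `Fin 72`, checks `rowMatrix 72 cert.HX / cert.HZ`):
* `no_xDecoder_radius_three` / `no_zDecoder_radius_three` — NO decoder of the `Z`-syndrome (resp. `X`-syndrome), i.e. no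
  function syndrome ↦ correction whatsoever, corrects every `X`-error (resp. `Z`-error) of weight `≤ 3`
  (Gottesman 1997 §2.3 «to correct t errors the distance must be at least 2t+1»; Delfosse–Nickerson §3 «tight»; here
  `2·3 ≮ 6`): `CSSCode.two_mul_lt_dX_of_correctsUpToX` (type-08 p459498) at `d_X = 6`.
* `no_pauliDecoder_radius_three` — NO Pauli decoder (any function of the pair of syndromes into `𝔽₂ⁿ × 𝔽₂ⁿ`, sector-wise
  or not) corrects every Pauli error of symplectic weight `≤ 3` modulo the stabilizer space: restrict it to pure bit flips
  (`correctsUpToX_of_correctsUpTo_pauli`, the forward half of CSS separation for an ARBITRARY decoder).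
* `radius_le_two` — hence every `t`-correcting Pauli decoder of `[[72,12,6]]` has `t ≤ 2`;
* `minWeight_isCorrectionRadiusX/Z/Pauli` — every minimum-weight decoder (sector-wise) has radius EXACTLY `2 = ⌊(6−1)/2⌋`
  (the Q4 «method = theorem» entry: `CSSCode.isCorrectionRadiusX_of_isMinWeight` at `d_X = 6`);
* `optimalRadius_two` — `2` is the maximum correction radius over all Pauli decoders AND it is attained by an explicit
  kernel-checked decoder (the certificate's syndrome tables, `BB72.isCorrectionRadiusPauli`).
Nothing probabilistic; «radius» is the adversarial (guaranteed-correction) radius of `SyndromeDecoding.lean`, not a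
threshold or a logical error rate (VALIDATED column, bench/VALIDATED.tsv).
-/

namespace Summit.Ventures.QEC.Decoders.BB72

open Matrix Literature.InformationTheory.QuantumCodes Summit.Ventures.QEC.Census Summit.Ventures.QEC.Census.BB72

/-- The code object of `Decoders/BB72SyndromeTable.lean` IS the code object of the distance theorems (the commutation
proof argument of `DistCert.code` is irrelevant to the value). -/
theorem code_eq : code = cert.code (cert.commOK_of_checkStructure structure_ok') := rfl

/-- `d_X = 6` for `code` — the certified distance (`BB72.dX_cert`: structural check + kernel mitm replay of the `X` side). -/
theorem dX_code : code.dX = 6 := dX_cert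

/-- `d_Z = 6` for `code` (`BB72.dZ_cert`). -/
theorem dZ_code : code.dZ = 6 := dZ_cert

/-- `[[72,12,6]]` has an `X`-type logical operator (`d_X = 6 > 0`, `CSSCode.dX_pos_iff`). -/
theorem exists_xLogical : ∃ v : Fin cert.n → ZMod 2, code.HZ *ᵥ v = 0 ∧ v ∉ code.rowSpX :=
  code.dX_pos_iff.1 (by rw [dX_code]; decide)

/-- `[[72,12,6]]` has a `Z`-type logical operator (`d_Z = 6 > 0`). -/
theorem exists_zLogical : ∃ v : Fin cert.n → ZMod 2, code.HX *ᵥ v = 0 ∧ v ∉ code.rowSpZ :=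
  code.dZ_pos_iff.1 (by rw [dZ_code]; decide)

/-! ## No decoder corrects three errors -/

/-- **No `X`-decoder of `[[72,12,6]]` corrects every `X`-error of weight `≤ 3`** — for ANY function `D` from
`Z`-syndromes to corrections (`2·3 < d_X = 6` would be forced, `CSSCode.two_mul_lt_dX_of_correctsUpToX`).
[cite: Gottesman1997, §2.3 (chunk p0014 L3: "to correct up to t errors must have distance at least 2t+1")] -/
theorem no_xDecoder_radius_three (D : Decoder (Fin cert.HZ.length → ZMod 2) (Fin cert.n → ZMod 2)) :
    ¬ D.CorrectsUpTo code.xSyndrome (code.rowSpX : Set (Fin cert.n → ZMod 2)) hammingNorm 3 := by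
  intro h
  have hlt := code.two_mul_lt_dX_of_correctsUpToX h exists_xLogical
  rw [dX_code] at hlt
  omega

/-- **No `Z`-decoder of `[[72,12,6]]` corrects every `Z`-error of weight `≤ 3`.**
[cite: Gottesman1997, §2.3 (chunk p0014 L3)] -/
theorem no_zDecoder_radius_three (D : Decoder (Fin cert.HX.length → ZMod 2) (Fin cert.n → ZMod 2)) :
    ¬ D.CorrectsUpTo code.zSyndrome (code.rowSpZ : Set (Fin cert.n → ZMod 2)) hammingNorm 3 := by
  intro h
  have hlt := code.two_mul_lt_dZ_of_correctsUpToZ h exists_zLogical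
  rw [dZ_code] at hlt
  omega

/-- **Restriction of an ARBITRARY Pauli decoder to pure bit flips** (the forward half of CSS separation without the
sector-wise assumption): if a decoder `D` of the pair of syndromes corrects every Pauli error of symplectic weight `≤ t`
modulo `SX × SZ`, then `σ ↦ (D (σ, synZ 0)).1` corrects every bit-flip pattern of Hamming weight `≤ t` modulo `SX`
(feed it the pure `X`-error `(a|0)`: its syndrome pair is `(synX a, synZ 0)` and the residual's `X`-part must lie in `SX`).
[cite: NielsenChuang2010, §10.4.2 (p. 450)] -/
theorem correctsUpToX_of_correctsUpTo_pauli {n : ℕ} {SynX SynZ : Type*} (synX : (Fin n → ZMod 2) → SynX)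
    (synZ : (Fin n → ZMod 2) → SynZ) (SX SZ : Submodule (ZMod 2) (Fin n → ZMod 2))
    (D : Decoder (SynX × SynZ) (SympVec n)) {t : ℕ}
    (h : D.CorrectsUpTo (cssSyndrome synX synZ) ((SX.prod SZ : Submodule (ZMod 2) (SympVec n)) : Set (SympVec n))
      sympWeight t) :
    Decoder.CorrectsUpTo (fun σ : SynX => (D (σ, synZ 0)).1) synX (SX : Set (Fin n → ZMod 2)) hammingNorm t := by
  intro a ha
  have h1 := h ((a, 0) : SympVec n) (by rwa [sympWeight_mk_zero_snd])
  simp only [Decoder.Corrects, cssSyndrome, SetLike.mem_coe, Submodule.mem_prod, Prod.fst_add, Prod.snd_add] at h1 ⊢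
  exact h1.1

/-- **No Pauli decoder of `[[72,12,6]]` — sector-wise or not — corrects every Pauli error of symplectic weight `≤ 3`**
modulo the stabilizer space `code.toSympCode = rs H^X × rs H^Z`. [cite: Gottesman1997, §2.3 (chunk p0014 L3)] -/
theorem no_pauliDecoder_radius_three
    (D : Decoder ((Fin cert.HZ.length → ZMod 2) × (Fin cert.HX.length → ZMod 2)) (SympVec cert.n)) :
    ¬ D.CorrectsUpTo (cssSyndrome code.xSyndrome code.zSyndrome) (code.toSympCode : Set (SympVec cert.n))
      sympWeight 3 :=
  fun h => no_xDecoder_radius_three (fun σ => (D (σ, code.zSyndrome 0)).1)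
    (correctsUpToX_of_correctsUpTo_pauli code.xSyndrome code.zSyndrome code.rowSpX code.rowSpZ D h)

/-- **Every `t`-correcting Pauli decoder of `[[72,12,6]]` has `t ≤ 2`.** [cite: Gottesman1997, §2.3 (chunk p0014 L3)] -/
theorem radius_le_two
    (D : Decoder ((Fin cert.HZ.length → ZMod 2) × (Fin cert.HX.length → ZMod 2)) (SympVec cert.n)) {t : ℕ}
    (h : D.CorrectsUpTo (cssSyndrome code.xSyndrome code.zSyndrome) (code.toSympCode : Set (SympVec cert.n))
      sympWeight t) : t ≤ 2 := by
  by_contra hlt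
  exact no_pauliDecoder_radius_three D (h.mono (by omega))

/-! ## Minimum-weight decoding attains radius 2 (method = theorem) -/

/-- **Every minimum-weight `X`-decoder of `[[72,12,6]]` has correction radius EXACTLY `2 = ⌊(d_X − 1)/2⌋`.**
[cite: DelfosseNickerson2021, §3 ¶2 (chunk p0006 L8–13: "up to (d−1)/2 … tight")] -/
theorem minWeight_isCorrectionRadiusX {D : Decoder (Fin cert.HZ.length → ZMod 2) (Fin cert.n → ZMod 2)}
    (hD : D.IsMinWeight code.xSyndrome (code.kerZ : Set (Fin cert.n → ZMod 2)) hammingNorm) :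
    D.IsCorrectionRadius code.xSyndrome (code.rowSpX : Set (Fin cert.n → ZMod 2)) hammingNorm 2 := by
  have h := code.isCorrectionRadiusX_of_isMinWeight hD exists_xLogical
  rwa [dX_code] at h

/-- **Every minimum-weight `Z`-decoder of `[[72,12,6]]` has correction radius EXACTLY `2`.**
[cite: DelfosseNickerson2021, §3 ¶2 (chunk p0006 L8–13)] -/
theorem minWeight_isCorrectionRadiusZ {D : Decoder (Fin cert.HX.length → ZMod 2) (Fin cert.n → ZMod 2)}
    (hD : D.IsMinWeight code.zSyndrome (code.kerX : Set (Fin cert.n → ZMod 2)) hammingNorm) :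
    D.IsCorrectionRadius code.zSyndrome (code.rowSpZ : Set (Fin cert.n → ZMod 2)) hammingNorm 2 := by
  have h := code.isCorrectionRadiusZ_of_isMinWeight hD exists_zLogical
  rwa [dZ_code] at h

/-- **Sector-wise minimum-weight decoding of `[[72,12,6]]` has Pauli correction radius EXACTLY `2`** (CSS separation).
[cite: DelfosseNickerson2021, §3 ¶2 (chunk p0006 L8–13)] [cite: NielsenChuang2010, §10.4.2 (p. 450)] -/
theorem minWeight_isCorrectionRadiusPauli {DX : Decoder (Fin cert.HZ.length → ZMod 2) (Fin cert.n → ZMod 2)}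
    {DZ : Decoder (Fin cert.HX.length → ZMod 2) (Fin cert.n → ZMod 2)}
    (hDX : DX.IsMinWeight code.xSyndrome (code.kerZ : Set (Fin cert.n → ZMod 2)) hammingNorm)
    (hDZ : DZ.IsMinWeight code.zSyndrome (code.kerX : Set (Fin cert.n → ZMod 2)) hammingNorm) :
    (Decoder.css DX DZ).IsCorrectionRadius (cssSyndrome code.xSyndrome code.zSyndrome)
      (code.toSympCode : Set (SympVec cert.n)) sympWeight 2 :=
  ⟨(code.css_correctsUpTo_iff DX DZ 2).2 ⟨(minWeight_isCorrectionRadiusX hDX).1, (minWeight_isCorrectionRadiusZ hDZ).1⟩,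
    no_pauliDecoder_radius_three _⟩

/-! ## Optimality, attained in the kernel -/

/-- **`2` is the optimal correction radius of `[[72,12,6]]`, and it is attained**: some explicit Pauli decoder (the
certificate's syndrome tables `treeX`/`treeZ`, `BB72.isCorrectionRadiusPauli`, KERNEL) has correction radius exactly `2`
in symplectic weight, and no Pauli decoder corrects more. [cite: Gottesman1997, §2.3 (chunk p0014 L3)] -/
theorem optimalRadius_two :
    (∃ D : Decoder ((Fin cert.HZ.length → ZMod 2) × (Fin cert.HX.length → ZMod 2)) (SympVec cert.n),
        D.IsCorrectionRadius (cssSyndrome code.xSyndrome code.zSyndrome) (code.toSympCode : Set (SympVec cert.n))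
          sympWeight 2) ∧
      ∀ (D : Decoder ((Fin cert.HZ.length → ZMod 2) × (Fin cert.HX.length → ZMod 2)) (SympVec cert.n)) (t : ℕ),
        D.CorrectsUpTo (cssSyndrome code.xSyndrome code.zSyndrome) (code.toSympCode : Set (SympVec cert.n))
          sympWeight t → t ≤ 2 :=
  ⟨⟨_, isCorrectionRadiusPauli⟩, fun D _ h => radius_le_two D h⟩

end Summit.Ventures.QEC.Decoders.BB72

/-! ## The typed code `BB.bb72 = QC(x³+y+y², y³+x+x²)` — the route's own object (appended)

The same optimality for the TYPED code of the route (`BB.bb72.css`, qubits `Mono 6 6 ⊕ Mono 6 6`) and its flat form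
(`BB.bb72.cssFlat`, qubits `Fin 72`), straight from the closed claim `BB72_12_6_claim_holds : HasParams BB.bb72 72 12 6`
through `Decoders/BBOptimalRadius.lean` — the shape every later BB row (`[[144,12,12]]` ⇒ radius 5, `[[90,8,10]]` ⇒ 4)
will take. -/

namespace Summit.Ventures.QEC.BB

open Literature.InformationTheory.QuantumCodes Literature.InformationTheory.QuantumCodes.BB
  Summit.Ventures.QEC.Census.BB72

/-- **`[[72,12,6]]`, typed code, `X`-sector**: some `X`-decoder of `BB.bb72.css` has correction radius EXACTLY `2`, and no
`X`-decoder corrects every `X`-error of weight `≤ 3` (from `BB72_12_6_claim_holds`). [cite: Gottesman1997, §2.3 (chunk p0014 L3)] -/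
theorem bb72_optimalRadiusX :
    (∃ D : Decoder (Mono 6 6 → ZMod 2) (Mono 6 6 ⊕ Mono 6 6 → ZMod 2),
        D.IsCorrectionRadius BB.bb72.css.xSyndrome (BB.bb72.css.rowSpX : Set (Mono 6 6 ⊕ Mono 6 6 → ZMod 2))
          hammingNorm 2) ∧
      ∀ (D : Decoder (Mono 6 6 → ZMod 2) (Mono 6 6 ⊕ Mono 6 6 → ZMod 2)) (t : ℕ),
        D.CorrectsUpTo BB.bb72.css.xSyndrome (BB.bb72.css.rowSpX : Set (Mono 6 6 ⊕ Mono 6 6 → ZMod 2)) hammingNorm t →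
          t ≤ 2 :=
  optimalRadiusX_of_hasParams BB72_12_6_claim_holds (by decide)

/-- **`[[72,12,6]]`, typed code, `Z`-sector**: radius EXACTLY `2` attained, no `Z`-decoder corrects 3 errors.
[cite: Gottesman1997, §2.3 (chunk p0014 L3)] -/
theorem bb72_optimalRadiusZ :
    (∃ D : Decoder (Mono 6 6 → ZMod 2) (Mono 6 6 ⊕ Mono 6 6 → ZMod 2),
        D.IsCorrectionRadius BB.bb72.css.zSyndrome (BB.bb72.css.rowSpZ : Set (Mono 6 6 ⊕ Mono 6 6 → ZMod 2))
          hammingNorm 2) ∧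
      ∀ (D : Decoder (Mono 6 6 → ZMod 2) (Mono 6 6 ⊕ Mono 6 6 → ZMod 2)) (t : ℕ),
        D.CorrectsUpTo BB.bb72.css.zSyndrome (BB.bb72.css.rowSpZ : Set (Mono 6 6 ⊕ Mono 6 6 → ZMod 2)) hammingNorm t →
          t ≤ 2 :=
  optimalRadiusZ_of_hasParams BB72_12_6_claim_holds (by decide)

/-- **`[[72,12,6]]`, flat code `BB.bb72.cssFlat` (qubits `Fin 72`), Pauli level**: some Pauli decoder has correction radius
EXACTLY `2` in symplectic weight and NO Pauli decoder, sector-wise or not, corrects every Pauli error of weight `≤ 3`.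
[cite: Gottesman1997, §2.3 (chunk p0014 L3)] [cite: DelfosseNickerson2021, §3 ¶2 (chunk p0006 L8–13)] -/
theorem bb72_optimalRadius_cssFlat :
    (∃ D : Decoder ((Fin (6 * 6) → ZMod 2) × (Fin (6 * 6) → ZMod 2)) (SympVec (6 * 6 + 6 * 6)),
        D.IsCorrectionRadius (cssSyndrome BB.bb72.cssFlat.xSyndrome BB.bb72.cssFlat.zSyndrome)
          (BB.bb72.cssFlat.toSympCode : Set (SympVec (6 * 6 + 6 * 6))) sympWeight 2) ∧
      ∀ (D : Decoder ((Fin (6 * 6) → ZMod 2) × (Fin (6 * 6) → ZMod 2)) (SympVec (6 * 6 + 6 * 6))) (t : ℕ),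
        D.CorrectsUpTo (cssSyndrome BB.bb72.cssFlat.xSyndrome BB.bb72.cssFlat.zSyndrome)
          (BB.bb72.cssFlat.toSympCode : Set (SympVec (6 * 6 + 6 * 6))) sympWeight t → t ≤ 2 :=
  optimalRadius_cssFlat_of_hasParams BB72_12_6_claim_holds (by decide)

end Summit.Ventures.QEC.BB
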